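import Literature.Probability.LatticeModels.EdgeKilledBeurling
import Literature.Probability.LatticeModels.GermRegionLattice
import HarnessLib

/-!
# One Beurling step for accessible suprema near a boundary point (line `symplectic-fermion-anchor`,
crux `SAWLoopFugacityFlow.AvoidanceLimit`, stmt-CriticalPhenomena-10649, stub W21a
`accessible_sup_decay`)

Let `D` be a Jordan domain, `δ > 0`, `q ∈ ∂D`, `Gr = discreteDomainGraph D δ` the edge-killed walk,
`Θ ⊆ Ω_δ` a vertex set which inside the ball `B(q, r)` is closed under kept edges and contained in
the finite set `S₀` on which `H ≥ 0` is killed-harmonic. For a scale `200 δ ≤ ρ ≤ r / 4` and a base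
site `x₁`, call a site of `Θ` *accessible at scale `ρ`* if it is joined to `x₁` by a `Gr`-walk
staying within `2ρ` of `q`. If `H ≤ M` at the accessible sites within `ρ` of `q`, then
`H ≤ (1 - c_*) · M` at the sites of `Θ` within `ρ / 10` of `q` joined to `x₁` by a walk within
`ρ / 5` of `q` (`accessible_sup_decay`, `c_* = maneuverConst`).

Proof: with `c` the lattice point nearest to `q / δ` and `k := ⌈(ρ / δ + 5) / 120⌉`, the start box
`mB c k` (sup-radius `12k`) contains every site within `ρ / 10` of `q`, while the region `mW c k`
(sup-radius `48k`) together with its lattice neighbours lies within distance `< ρ` of `q`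
(`accessibleDecay_mem_mB`, `accessibleDecay_dist_lt`). On `R := A ∩ mW c k`, `A` the accessible set,
`H ≤ M · edgeSurvive Gr (mW c k)` by the ratio hull principle of `KilledHarmonicRatio.lean`: an
exit site of `R` is a kept neighbour of an accessible site of the box, hence lies in `Θ`
(closure), is accessible (the walk extended by the kept edge stays within `ρ < 2ρ` of `q`), so it is
outside the box, where `edgeSurvive = 1` and `H ≤ M` by hypothesis. On `mB c k` the survival
probability is at most `1 - c_*` by the one-scale maneuver `JordanDomain.edgeKilled_survive_le`
(`EdgeKilledAnnulusManeuver.lean`). Everything is proved; no definitions.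
Source: S. Smirnov, *Conformal invariance in random cluster models. I*, Ann. of Math. 172 (2010),
Lemma B.2 [Smirnov2010]; D. Chelkak, *Robust discrete complex analysis: a toolbox*, Ann. Probab.
44 (2016), Lemma 2.11 [Chelkak2016].
-/

noncomputable section

open scoped BigOperators Classical
open Set Metric Filter Topology
open Literature.Topology.PlaneTopology
open Literature.Probability.LatticeModels
open Literature.Probability.RandomPlanarGeometry (JordanDomain)

namespace Summit.CriticalPhenomena.SAWScalingLimit.Theorems.AvoidanceLimit.Anchor

/-! ### Real / integer bookkeeping for the lattice boxes about the point nearest to `q / δ` -/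

/-- If `|δ a - x| ≤ ρ'` and `n` is within `1/2` of `x / δ`, then `|a - n| ≤ T` as soon as
`ρ' + δ / 2 ≤ δ T`. [folklore] -/
theorem accessibleDecay_abs_sub_le {δ x ρ' T : ℝ} (hδ : 0 < δ) {a n : ℤ}
    (h1 : |δ * a - x| ≤ ρ') (h2 : |x / δ - n| ≤ 1 / 2) (hT : ρ' + δ / 2 ≤ δ * T) :
    |((a : ℤ) : ℝ) - n| ≤ T := by
  have h2' : |x - δ * n| ≤ δ / 2 := by
    have e : x - δ * n = δ * (x / δ - n) := by field_simp
    rw [e, abs_mul, abs_of_pos hδ]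
    calc δ * |x / δ - n| ≤ δ * (1 / 2) := mul_le_mul_of_nonneg_left h2 hδ.le
      _ = δ / 2 := by ring
  have h3 : |δ * a - δ * n| ≤ ρ' + δ / 2 := (abs_sub_le _ x _).trans (add_le_add h1 h2')
  rw [← mul_sub, abs_mul, abs_of_pos hδ] at h3
  exact le_of_mul_le_mul_left (h3.trans hT) hδ

/-- A coordinate of a mesh point within `ρ'` of `x` differs from the rounded `x / δ` by at most `T`
lattice units once `ρ' + δ/2 ≤ δ T` (integer form). [folklore] -/
theorem accessibleDecay_int_abs_sub_le {δ x ρ' : ℝ} (hδ : 0 < δ) {a n T : ℤ}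
    (h1 : |δ * a - x| ≤ ρ') (h2 : |x / δ - n| ≤ 1 / 2) (hT : ρ' + δ / 2 ≤ δ * T) :
    |a - n| ≤ T := by
  have := accessibleDecay_abs_sub_le hδ h1 h2 hT
  exact_mod_cast this

/-- **Inner box.** If `120 k δ ≥ ρ + 5 δ` and `c` is the rounding of `q / δ`, every site within
`ρ / 10` of `q` lies in the start box `mB c k` of sup-radius `12k`. [folklore] -/
theorem accessibleDecay_mem_mB {δ ρ : ℝ} (hδ : 0 < δ) {q : ℂ} {c v : Site 2} {k : ℕ}
    (hk : ρ + 5 * δ ≤ 120 * k * δ) (hc0 : |q.re / δ - c 0| ≤ 1 / 2) (hc1 : |q.im / δ - c 1| ≤ 1 / 2)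
    (hv : dist (meshPoint δ v) q ≤ ρ / 10) : v ∈ mB c k := by
  rw [Complex.dist_eq] at hv
  have hre := (Complex.abs_re_le_norm _).trans hv
  have him := (Complex.abs_im_le_norm _).trans hv
  rw [Complex.sub_re, meshPoint_re] at hre
  rw [Complex.sub_im, meshPoint_im] at him
  have hT : ρ / 10 + δ / 2 ≤ δ * ((12 * (k : ℕ) : ℤ) : ℝ) := by push_cast; linarith
  exact ⟨accessibleDecay_int_abs_sub_le hδ hre hc0 hT, accessibleDecay_int_abs_sub_le hδ him hc1 hT⟩

/-- **Outer box.** If `(120 k - 125) δ < ρ`, `200 δ ≤ ρ` and `c` is the rounding of `q / δ`, every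
site within sup-distance `48k + 1` of `c` has its mesh point within distance `< ρ` of `q`
(`48kδ + 3δ/2 < 0.4ρ + 51.5δ ≤ 0.66ρ` per coordinate, and `√2 · 0.66 < 1`). [folklore] -/
theorem accessibleDecay_dist_lt {δ ρ : ℝ} (hδ : 0 < δ) (hρ : 200 * δ ≤ ρ) {q : ℂ} {c w : Site 2} {k : ℕ}
    (hk : (120 * (k : ℝ) - 125) * δ < ρ) (hc0 : |q.re / δ - c 0| ≤ 1 / 2)
    (hc1 : |q.im / δ - c 1| ≤ 1 / 2) (hw0 : |w 0 - c 0| ≤ 48 * k + 1) (hw1 : |w 1 - c 1| ≤ 48 * k + 1) :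
    dist (meshPoint δ w) q < ρ := by
  have hρ0 : 0 < ρ := by linarith
  have hw0' : |((w 0 : ℤ) : ℝ) - c 0| ≤ 48 * k + 1 := by exact_mod_cast hw0
  have hw1' : |((w 1 : ℤ) : ℝ) - c 1| ≤ 48 * k + 1 := by exact_mod_cast hw1
  set A : ℝ := δ * (48 * k + 1) + δ * (1 / 2) with hA
  have hA0 : 0 ≤ A := by positivity
  have hAρ : A < 7 / 10 * ρ := by
    have hk0 : (0 : ℝ) ≤ k := Nat.cast_nonneg k
    nlinarith
  have hcoord : ∀ (a n : ℤ) (x : ℝ), |x / δ - n| ≤ 1 / 2 → |((a : ℤ) : ℝ) - n| ≤ 48 * k + 1 →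
      |δ * a - x| ≤ A := by
    intro a n x hn ha
    have e : δ * a - x = δ * (a - n) + δ * (n - x / δ) := by field_simp; ring
    rw [e]
    refine (abs_add_le _ _).trans ?_
    rw [abs_mul, abs_mul, abs_of_pos hδ, abs_sub_comm (n : ℝ)]
    exact add_le_add (mul_le_mul_of_nonneg_left ha hδ.le) (mul_le_mul_of_nonneg_left hn hδ.le)
  have hre : |(meshPoint δ w - q).re| ≤ A := by
    rw [Complex.sub_re, meshPoint_re]; exact hcoord _ _ _ hc0 hw0'
  have him : |(meshPoint δ w - q).im| ≤ A := by
    rw [Complex.sub_im, meshPoint_im]; exact hcoord _ _ _ hc1 hw1'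
  have hre2 : (meshPoint δ w - q).re ^ 2 ≤ A ^ 2 := sq_le_sq' (abs_le.1 hre).1 (abs_le.1 hre).2
  have him2 : (meshPoint δ w - q).im ^ 2 ≤ A ^ 2 := sq_le_sq' (abs_le.1 him).1 (abs_le.1 him).2
  have hA2 : A ^ 2 < (7 / 10 * ρ) ^ 2 := pow_lt_pow_left₀ hAρ hA0 two_ne_zero
  have h2 : ‖meshPoint δ w - q‖ ^ 2 < ρ ^ 2 := by
    rw [Complex.sq_norm, Complex.normSq_apply, ← pow_two, ← pow_two]
    nlinarith [sq_nonneg ρ]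
  rw [Complex.dist_eq]
  exact lt_of_pow_lt_pow_left₀ 2 hρ0.le h2

/-- A lattice neighbour of a site of the region `mW c k` is within sup-distance `48k + 1` of `c`.
[folklore] -/
theorem accessibleDecay_abs_add_stepVec_le {c v : Site 2} {k : ℕ} (hv : v ∈ mW c k) (e : SRW.Dir 2)
    (i : Fin 2) : |(v + SRW.stepVec e) i - c i| ≤ 48 * k + 1 := by
  have he := SRW.abs_stepVec_apply_le e i
  have hvi : |v i - c i| ≤ 48 * k := by
    fin_cases i
    · exact hv.1
    · exact hv.2
  rw [Pi.add_apply]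
  rw [abs_le] at he hvi ⊢
  constructor <;> omega

/-! ### The Beurling step -/

/-- **One Beurling step for accessible suprema near a boundary point.** Let `D` be a Jordan domain,
`δ > 0`, `q ∈ ∂D`, `Gr = discreteDomainGraph D δ`, `Θ ⊆ Ω_δ` a vertex set which inside `B(q, r)` is
contained in the finite set `S₀` (where `H ≥ 0` is killed-harmonic) and closed under kept edges, and
`x₁ ∈ Θ` a base site. For `200 δ ≤ ρ`, `4 ρ ≤ r`, `0 ≤ M`: if `H ≤ M` at every site of `Θ` within `ρ`
of `q` joined to `x₁` by a `Gr`-walk staying within `2ρ` of `q`, then `H ≤ (1 - maneuverConst) · M`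
at every site of `Θ` within `ρ / 10` of `q` joined to `x₁` by a walk staying within `ρ / 5` of `q`.
Proof: comparison of `H` with `M · edgeSurvive Gr (mW c k)` on the accessible part of the box
`mW c k` about the lattice point `c` nearest to `q / δ`, `k = ⌈(ρ/δ + 5)/120⌉` (ratio hull principle;
the exit sites are accessible kept neighbours outside the box, where `edgeSurvive = 1` and `H ≤ M`),
then the one-scale maneuver `JordanDomain.edgeKilled_survive_le` on `mB c k`, which contains the
sites within `ρ / 10` of `q`. [cite: Smirnov2010, Lemma B.2; Chelkak2016, Lemma 2.11] -/
theorem accessible_sup_decay :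
    ∀ (D : JordanDomain) (δ : ℝ), 0 < δ → ∀ q ∈ frontier D.carrier, ∀ (Θ S₀ : Set (Site 2)) (H : Site 2 → ℝ) (r : ℝ),
      0 < r → Θ ⊆ meshDomain D.carrier δ → S₀.Finite → (∀ w, 0 ≤ H w) →
      IsKilledHarmonicOn (discreteDomainGraph D.carrier δ) H S₀ →
      (∀ v ∈ Θ, dist (meshPoint δ v) q < r → v ∈ S₀) →
      (∀ v ∈ Θ, dist (meshPoint δ v) q < r → ∀ e : SRW.Dir 2,
        (discreteDomainGraph D.carrier δ).Adj v (v + SRW.stepVec e) → v + SRW.stepVec e ∈ Θ) →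
      ∀ (x₁ : Site 2), x₁ ∈ Θ → ∀ (ρ M : ℝ), 200 * δ ≤ ρ → 4 * ρ ≤ r → 0 ≤ M →
      (∀ v ∈ Θ, (∃ p : (discreteDomainGraph D.carrier δ).Walk x₁ v,
          ∀ w ∈ p.support, dist (meshPoint δ w) q < 2 * ρ) → dist (meshPoint δ v) q ≤ ρ → H v ≤ M) →
      ∀ v ∈ Θ, (∃ p : (discreteDomainGraph D.carrier δ).Walk x₁ v,
          ∀ w ∈ p.support, dist (meshPoint δ w) q < ρ / 5) → dist (meshPoint δ v) q ≤ ρ / 10 →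
        H v ≤ (1 - maneuverConst) * M := by
  intro D δ hδ q hq Θ S₀ H r _hr _hΘ _hS₀ _hH0 hH hΘS hcl x₁ _hx₁ ρ M hρ hρr hM hyp v hv hwalk hdist
  have hρ0 : 0 < ρ := by linarith
  set Gr := discreteDomainGraph D.carrier δ with hGr
  -- the centre: the lattice point nearest to `q / δ`
  set c : Site 2 := nearestSite δ q with hc
  have hc0 : |q.re / δ - c 0| ≤ 1 / 2 := by
    rw [show c 0 = round (q.re / δ) from rfl]; exact abs_sub_round _
  have hc1 : |q.im / δ - c 1| ≤ 1 / 2 := by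
    rw [show c 1 = round (q.im / δ) from rfl]; exact abs_sub_round _
  -- the scale `k = ⌈(ρ/δ + 5)/120⌉`: `ρ + 5δ ≤ 120kδ < ρ + 125δ`
  set k : ℕ := ⌈(ρ / δ + 5) / 120⌉₊ with hk
  have hρδ : 0 < ρ / δ := div_pos hρ0 hδ
  have hkpos : 0 < k := Nat.ceil_pos.2 (by positivity)
  have hk_lo : ρ + 5 * δ ≤ 120 * k * δ := by
    have h1 : (ρ / δ + 5) / 120 ≤ k := Nat.le_ceil _
    have h2 : ρ / δ ≤ 120 * k - 5 := by linarith
    rw [div_le_iff₀ hδ] at h2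
    linarith
  have hk_hi : (120 * (k : ℝ) - 125) * δ < ρ := by
    have h1 : (k : ℝ) < (ρ / δ + 5) / 120 + 1 := Nat.ceil_lt_add_one (by positivity)
    have h2 : 120 * (k : ℝ) - 125 < ρ / δ := by linarith
    rwa [lt_div_iff₀ hδ] at h2
  have hk1 : (1 : ℝ) ≤ k := by exact_mod_cast hkpos
  have hq0 : |q.re / δ - c 0| < 12 * k := hc0.trans_lt (by linarith)
  have hq1 : |q.im / δ - c 1| < 12 * k := hc1.trans_lt (by linarith)
  -- every site of the region `mW c k`, and every lattice neighbour of such a site, is within `ρ` of `q`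
  have hWnear : ∀ w ∈ mW c k, dist (meshPoint δ w) q < ρ := fun w hw =>
    accessibleDecay_dist_lt hδ hρ hk_hi hc0 hc1 (hw.1.trans (by linarith)) (hw.2.trans (by linarith))
  have hWnear' : ∀ w ∈ mW c k, ∀ e : SRW.Dir 2, dist (meshPoint δ (w + SRW.stepVec e)) q < ρ :=
    fun w hw e => accessibleDecay_dist_lt hδ hρ hk_hi hc0 hc1
      (accessibleDecay_abs_add_stepVec_le hw e 0) (accessibleDecay_abs_add_stepVec_le hw e 1)
  -- the accessible set at scale `ρ` and its part `R` in the region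
  set A : Set (Site 2) :=
    {u | u ∈ Θ ∧ ∃ p : Gr.Walk x₁ u, ∀ w ∈ p.support, dist (meshPoint δ w) q < 2 * ρ} with hA
  set R : Set (Site 2) := A ∩ mW c k with hR
  have hRfin : R.Finite := (mW_finite c k).subset Set.inter_subset_right
  have hRS : R ⊆ S₀ := fun u hu => hΘS u hu.1.1 ((hWnear u hu.2).trans_le (by linarith))
  have h1 : IsKilledHarmonicOn Gr H R := hH.mono hRS
  have h2 : IsKilledHarmonicOn Gr (edgeSurvive Gr (mW c k)) R :=
    (killedHarmExt_harmonicOn (mW_finite c k) _).mono Set.inter_subset_right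
  -- on the exit set of `R`: accessible kept neighbours outside the box, where `edgeSurvive = 1`
  have hbd : ∀ w ∈ killedOuterBoundary Gr R, H w ≤ M * edgeSurvive Gr (mW c k) w := by
    rintro w ⟨hwR, u, huR, e, rfl, hadj⟩
    obtain ⟨⟨huΘ, p, hp⟩, huW⟩ := huR
    have hu_r : dist (meshPoint δ u) q < r := (hWnear u huW).trans_le (by linarith)
    have hwΘ : u + SRW.stepVec e ∈ Θ := hcl u huΘ hu_r e hadj
    have hw_near : dist (meshPoint δ (u + SRW.stepVec e)) q < ρ := hWnear' u huW e
    have hsupp : ∀ z ∈ (p.concat hadj).support, dist (meshPoint δ z) q < 2 * ρ := by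
      intro z hz
      rw [SimpleGraph.Walk.support_concat, List.mem_append, List.mem_singleton] at hz
      rcases hz with hz | rfl
      · exact hp z hz
      · linarith
    have hwA : u + SRW.stepVec e ∈ A := ⟨hwΘ, p.concat hadj, hsupp⟩
    have hwW : u + SRW.stepVec e ∉ mW c k := fun h => hwR ⟨hwA, h⟩
    rw [edgeSurvive_of_not_mem hwW, mul_one]
    exact hyp _ hwΘ ⟨p.concat hadj, hsupp⟩ hw_near.le
  have hcmp := h1.le_mul_of_forall_boundary hRfin h2 hbd
  -- the target site lies in `R` and in the start box `mB c k`
  obtain ⟨p₅, hp₅⟩ := hwalk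
  have hvA : v ∈ A := ⟨hv, p₅, fun w hw => (hp₅ w hw).trans (by linarith)⟩
  have hvB : v ∈ mB c k := accessibleDecay_mem_mB hδ hk_lo hc0 hc1 hdist
  have hvR : v ∈ R := ⟨hvA, mB_subset_mW hvB⟩
  have hsurv : edgeSurvive Gr (mW c k) v ≤ 1 - maneuverConst :=
    D.edgeKilled_survive_le hδ hkpos hq hq0 hq1 hvB
  calc H v ≤ M * edgeSurvive Gr (mW c k) v := hcmp v hvR
    _ ≤ M * (1 - maneuverConst) := mul_le_mul_of_nonneg_left hsurv hM
    _ = (1 - maneuverConst) * M := mul_comm _ _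

end Summit.CriticalPhenomena.SAWScalingLimit.Theorems.AvoidanceLimit.Anchor

end
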